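import Summits.QuantumFields.BalabanUV.Beta.MultiscaleDecayRowSums

/-!
# Beta / MultiscaleDecayRowSumsAdd — THE WEIGHTED-ROW-SUM ENDS UNDER THE ADDITIVE (STEP-FUNCTION) GRADING (MODEL; O.2 item (ii-c), v2 of the
# geometry clause after t4-ne9-formalise-leaf-04-g28's O-ne9leaf04g28-1 «RIGID GRADING»)

`MultiscaleDecayRowSums` §3 fed its graded comparison from the BONDWISE clause of `MultiscaleDistanceGraded` §2, which on the torus admits
only CONSTANT scales (ℕ-valued exponent, `slen ≤ 1`, `R > 1`; O-ne9leaf04g28-1, journal l.19783 — TRUE but vacuous beyond one scale).  This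
file re-plumbs the ENDs on the ADDITIVE two-point datum `|e(x) − e(y)| ≤ A + d_n(x,y)/R` of `MultiscaleDistanceGraded` §4 (v1.1) — the
correct MODEL of [B6] (2.1)–(2.2)'s step geometry (`A = 1`) —: §1 **`wrs_le_of_entry_decay_mul`** (§2 of the parent file with a CONSTANT `C_g`
in the graded comparison `n(x′) ≤ C_g·n(x)·e^{cD(x,x′)}`), §2 the torus ENDs **`wrs_inv_levelOp_le_add`**, **`wrs_dirInv_levelOp_le_add`**
(constant `× L^A`; no reachability argument needed)
(unit `b2b-balaban-beta-d4-p2`, GEN 8, MODEL crew; claim «MULTISCALE-DECAY-MODEL» l.18614; over p232228 and `MultiscaleDistanceGraded` v1.1).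

HONEST FRAMING: discharging `BetaPertH` makes Bałaban's UV stability UNCONDITIONAL — NOT the continuum limit, NOT the Clay problem.
HONEST DEPENDENCY (verbatim): «continuum YM on T⁴ ⇐ BetaPertH ∧ nine spine estimates (0/9 proved); BetaPertH ⇐ (D1) ∧ (D4) ∧ CAP+tail;
G-an2-4 gates asym, D1 and NE2/3/4.»  THIS MODULE DISCHARGES NOTHING of `BetaPertH`, asserts NOTHING printed and cites nothing as a fact
(ABSOLUTE RULE): [folklore] summation bookkeeping; the additive grading and the growth clause are HYPOTHESES ON DATA (SHAPE of (2.1)–(2.2)).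
LOCI (shape only): [B6] = `Balaban1984PropagatorsII` (2.1)–(2.2) p. 224, (2.46) p. 231; [B9] = `Balaban1985BackgroundPropagators` (3.41)–(3.42)
p. 397; [II] = `Balaban1988RG2Cluster` (2.16) p. 15.  No class change on row D4 (critical-path width 0; D4 DISCHARGE NO DATE); NOT BetaPertH, NOT
continuum, NOT Clay, NOT summit progress.
-/

namespace Summit.QuantumFields.BalabanUV.Beta.MultiscaleDecayRowSumsAdd

open Finset Function
open Summit.QuantumFields.BalabanUV.Beta.BoxPoincare (Box)
open Summit.QuantumFields.BalabanUV.Beta.CovariantBoxPoincare (hol succ)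
open Summit.QuantumFields.BalabanUV.Beta.MultiscaleCoerciveTorus
open Summit.QuantumFields.BalabanUV.Beta.MultiscaleDistance
open Summit.QuantumFields.BalabanUV.Beta.MultiscaleDistanceGraded
open Summit.QuantumFields.BalabanUV.Beta.MultiscaleDecayBudget
open Summit.QuantumFields.BalabanUV.Beta.MultiscaleDecay
open Summit.QuantumFields.BalabanUV.Beta.MultiscaleDecayDirichlet
open Summit.QuantumFields.BalabanUV.Beta.MultiscaleDecayRowSums (sum_exp_neg_le_of_growth)
open Literature.MathematicalPhysics.QuantumFieldTheory.Balaban1983to89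
open Literature.MathematicalPhysics.QuantumFieldTheory.Balaban1983to89.B9Thm37Sum (mulOp)
open Literature.MathematicalPhysics.QuantumFieldTheory.Balaban1983to89.B9Thm37GluePU (bsrc btgt)
open Literature.MathematicalPhysics.QuantumFieldTheory.Balaban1983to89.B9Thm37GlueTorusCov (tblk torusComb)
open Literature.MathematicalPhysics.QuantumFieldTheory.Balaban1983to89.B9Thm37GlueTorusCovLevels (levelOp)
open Literature.MathematicalPhysics.QuantumFieldTheory.Balaban1983to89.B9Thm37GlueTorusInv (dirInv)
open B5TorusCover (UT Ctr ctrU)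

noncomputable section

/-! ## §1 Weighted row sums from entry decay with a constant in the graded comparison -/

section WRS

variable {X Cp : Type} [Fintype X] [Fintype Cp]

/-- **WEIGHTED ROW SUMS FROM ENTRY DECAY, graded comparison with a constant** (`n(x′) ≤ C_g·n(x)·e^{cD(x,x′)}`): as
`MultiscaleDecayRowSums.wrs_le_of_entry_decay` with the bound multiplied by `C_g`. [cite: Balaban1988RG2Cluster, (2.16) p.15] -/
theorem wrs_le_of_entry_decay_mul (D : X → X → ℝ) (hD : ∀ x x', 0 ≤ D x x') (n : X → ℕ) {Cg c : ℝ} (hCg : 0 ≤ Cg)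
    (hgr : ∀ x x', (n x' : ℝ) ≤ Cg * n x * Real.exp (c * D x x')) {G₀ Λ : ℝ} (hG₀ : 0 ≤ G₀) (hΛ : 0 ≤ Λ) {d₀ : ℕ}
    (hgrowth : ∀ x (m : ℕ), ((univ.filter fun x' => D x x' < m).card : ℝ) ≤ G₀ * (n x : ℝ) ^ d₀ * Λ ^ m)
    (G : X × Cp → X × Cp → ℝ) {B κ : ℝ} (hB : 0 ≤ B)
    (hG : ∀ p q, |G p q| ≤ B * Real.exp (-(κ * D p.1 q.1)) * ((n p.1 : ℝ) * n q.1)) {κ' : ℝ} (hδ : 0 ≤ κ - κ' - c)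
    (hq : Λ * Real.exp (-(κ - κ' - c)) < 1) (p : X × Cp) :
    ∑ q, |G p q| * Real.exp (κ' * D p.1 q.1) ≤
      B * Cg * (Fintype.card Cp) * (G₀ * Λ / (1 - Λ * Real.exp (-(κ - κ' - c)))) * (n p.1 : ℝ) ^ (d₀ + 2) := by
  set δ := κ - κ' - c with hδdef
  have hn0 : (0 : ℝ) ≤ n p.1 := Nat.cast_nonneg _
  have hterm : ∀ q : X × Cp, |G p q| * Real.exp (κ' * D p.1 q.1) ≤ B * Cg * (n p.1 : ℝ) ^ 2 * Real.exp (-(δ * D p.1 q.1)) := by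
    intro q
    have h1 := hG p q
    have h2 := hgr p.1 q.1
    have he0 : 0 ≤ Real.exp (κ' * D p.1 q.1) := (Real.exp_pos _).le
    calc |G p q| * Real.exp (κ' * D p.1 q.1)
        ≤ B * Real.exp (-(κ * D p.1 q.1)) * ((n p.1 : ℝ) * n q.1) * Real.exp (κ' * D p.1 q.1) :=
          mul_le_mul_of_nonneg_right h1 he0
      _ ≤ B * Real.exp (-(κ * D p.1 q.1)) * ((n p.1 : ℝ) * (Cg * n p.1 * Real.exp (c * D p.1 q.1))) * Real.exp (κ' * D p.1 q.1) := by
          refine mul_le_mul_of_nonneg_right (mul_le_mul_of_nonneg_left (mul_le_mul_of_nonneg_left h2 hn0)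
            (mul_nonneg hB (Real.exp_pos _).le)) he0
      _ = B * Cg * (n p.1 : ℝ) ^ 2 * (Real.exp (-(κ * D p.1 q.1)) * Real.exp (c * D p.1 q.1) * Real.exp (κ' * D p.1 q.1)) := by
          ring
      _ = B * Cg * (n p.1 : ℝ) ^ 2 * Real.exp (-(δ * D p.1 q.1)) := by
          have hexp : -(κ * D p.1 q.1) + c * D p.1 q.1 + κ' * D p.1 q.1 = -(δ * D p.1 q.1) := by rw [hδdef]; ring
          rw [← Real.exp_add, ← Real.exp_add, hexp]
  have hsum : ∑ q : X × Cp, B * Cg * (n p.1 : ℝ) ^ 2 * Real.exp (-(δ * D p.1 q.1)) =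
      B * Cg * (n p.1 : ℝ) ^ 2 * (Fintype.card Cp) * ∑ x', Real.exp (-(δ * D p.1 x')) := by
    rw [Fintype.sum_prod_type]
    simp only [Finset.sum_const, Finset.card_univ, nsmul_eq_mul, Finset.mul_sum]
    refine Finset.sum_congr rfl fun x' _ => ?_
    ring
  have hshell := sum_exp_neg_le_of_growth (fun x' => D p.1 x') (fun x' => hD p.1 x') (mul_nonneg hG₀ (pow_nonneg hn0 d₀)) hΛ
    (fun m => hgrowth p.1 m) hδ hq
  calc ∑ q, |G p q| * Real.exp (κ' * D p.1 q.1)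
      ≤ ∑ q : X × Cp, B * Cg * (n p.1 : ℝ) ^ 2 * Real.exp (-(δ * D p.1 q.1)) := Finset.sum_le_sum fun q _ => hterm q
    _ = B * Cg * (n p.1 : ℝ) ^ 2 * (Fintype.card Cp) * ∑ x', Real.exp (-(δ * D p.1 x')) := hsum
    _ ≤ B * Cg * (n p.1 : ℝ) ^ 2 * (Fintype.card Cp) * (G₀ * (n p.1 : ℝ) ^ d₀ * Λ / (1 - Λ * Real.exp (-δ))) :=
        mul_le_mul_of_nonneg_left hshell (by positivity)
    _ = B * Cg * (Fintype.card Cp) * (G₀ * Λ / (1 - Λ * Real.exp (-(κ - κ' - c)))) * (n p.1 : ℝ) ^ (d₀ + 2) := by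
        rw [hδdef]; ring

end WRS

/-! ## §2 The torus ENDs under the additive grading -/

section Torus

variable {d : ℕ} {N : Fin d → ℕ} [∀ i, NeZero (N i)] [NeZero d] {Cp J K : Type} [Fintype Cp] [DecidableEq Cp] [Fintype J] [Fintype K]
  (S : J → ℕ) (hS : ∀ l, 1 ≤ S l) (hdivS : ∀ l i, S l ∣ N i) (lvl : K → J) (zc : (k : K) → Ctr N (S (lvl k)))

/-- **LEVEL-FREE WEIGHTED ROW SUMS OF `(levelOp)⁻¹` UNDER THE ADDITIVE GRADING (MODEL; item (ii-c) v2).**  As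
`MultiscaleDecayRowSums.wrs_inv_levelOp_le` with the graded clause replaced by the ADDITIVE datum `|e(x) − e(y)| ≤ A + d_n(x,y)/R` for all
sites (`A = 1` = print's step geometry); the constant picks up `L^A`:
`Σ_q |(levelOp)⁻¹(δ_q)(p)|·e^{κ′d_n(p₁,q₁)} ≤ μ₀⁻¹·L^A·|Cp|·G₀Λ/(1 − Λe^{−(κ−κ′−log L/R)})·n(p₁)^{d₀+2}`.
[cite: Balaban1988RG2Cluster, (2.16) p.15; Balaban1985BackgroundPropagators, (3.41)-(3.42) p.397; Balaban1984PropagatorsII, (2.1)-(2.2) p.224] -/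
theorem wrs_inv_levelOp_le_add (hdisj : ∀ k k' v v', cellPt S hS hdivS lvl zc k v = cellPt S hS hdivS lvl zc k' v' → k = k')
    (hcover : ∀ x : UT N, ∃ k, ∃ v : Box d (S (lvl k)), cellPt S hS hdivS lvl zc k v = x)
    (Rm : UT N × Fin d → Cp → Cp → ℝ) (hRm : ∀ b i j, ∑ k, Rm b k i * Rm b k j = if i = j then (1 : ℝ) else 0)
    (T : J → UT N → Cp → Cp → ℝ) (hT : ∀ l x i i', ∑ k, T l x k i * T l x k i' = if i = i' then (1 : ℝ) else 0)
    (a : J → ℝ) (ha : ∀ j, 0 ≤ a j) (ω : J → UT N → ℝ)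
    (hsupp : ∀ l x, ω l (ctrU N (S l) (tblk (hS l) (hdivS l) x)) ≠ 0 → ∃ k v, lvl k = l ∧ cellPt S hS hdivS lvl zc k v = x)
    {amax : ℝ} (hamax : 0 ≤ amax)
    (hscale : ∀ k, a (lvl k) * ω (lvl k) (ctrU N (S (lvl k)) (zc k)) ^ 2 * (S (lvl k) : ℝ) ^ d ≤ amax / (S (lvl k) : ℝ) ^ 2)
    (c : UT N × Fin d → ℝ) {cmax : ℝ} (hc : ∀ b, |c b| ≤ cmax) {C : ℝ}
    (hcoer : ∀ f : UT N × Cp → ℝ,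
      C * ∑ k, ((S (lvl k) : ℝ) ^ 2)⁻¹ * ∑ v : Box d (S (lvl k)), ∑ i, f (cellPt S hS hdivS lvl zc k v, i) ^ 2 ≤
        ∑ p, f p * levelOp bsrc btgt c Rm (fun l x => ctrU N (S l) (tblk (hS l) (hdivS l) x))
          (fun l x => ω l (ctrU N (S l) (tblk (hS l) (hdivS l) x))) T a f p)
    {κ : ℝ} (hκ0 : 0 ≤ κ) (hκ1 : κ ≤ 1) (hμ : 0 < C - 2 * d * cmax ^ 2 * κ ^ 2 - amax * (Real.exp (2 * d * κ) - 1))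
    {L : ℕ} (hL : 1 ≤ L) (e : UT N → ℕ) (hne : ∀ x, siteScale S hS hdivS lvl zc hcover x = L ^ e x) {R : ℝ} {A : ℕ}
    (hadd : ∀ x y : UT N, |(e x : ℝ) - e y| ≤ A + sdist bsrc btgt (siteScale S hS hdivS lvl zc hcover) x y / R)
    {G₀ Λ : ℝ} (hG₀ : 0 ≤ G₀) (hΛ : 0 ≤ Λ) {d₀ : ℕ}
    (hgrowth : ∀ x (m : ℕ), ((univ.filter fun x' => sdist bsrc btgt (siteScale S hS hdivS lvl zc hcover) x x' < m).card : ℝ) ≤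
      G₀ * (siteScale S hS hdivS lvl zc hcover x : ℝ) ^ d₀ * Λ ^ m)
    {κ' : ℝ} (hδ : 0 ≤ κ - κ' - Real.log L / R) (hq : Λ * Real.exp (-(κ - κ' - Real.log L / R)) < 1) (p : UT N × Cp) :
    ∑ q, |Ring.inverse (levelOp bsrc btgt c Rm (fun l x => ctrU N (S l) (tblk (hS l) (hdivS l) x))
          (fun l x => ω l (ctrU N (S l) (tblk (hS l) (hdivS l) x))) T a) (Pi.single q 1) p| *
        Real.exp (κ' * sdist bsrc btgt (siteScale S hS hdivS lvl zc hcover) p.1 q.1) ≤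
      (C - 2 * d * cmax ^ 2 * κ ^ 2 - amax * (Real.exp (2 * d * κ) - 1))⁻¹ * (L : ℝ) ^ A * (Fintype.card Cp) *
        (G₀ * Λ / (1 - Λ * Real.exp (-(κ - κ' - Real.log L / R)))) * (siteScale S hS hdivS lvl zc hcover p.1 : ℝ) ^ (d₀ + 2) := by
  set n := siteScale S hS hdivS lvl zc hcover with hn
  set μ₀ := C - 2 * d * cmax ^ 2 * κ ^ 2 - amax * (Real.exp (2 * d * κ) - 1) with hμ₀
  set Aop := levelOp bsrc btgt c Rm (fun l x => ctrU N (S l) (tblk (hS l) (hdivS l) x))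
    (fun l x => ω l (ctrU N (S l) (tblk (hS l) (hdivS l) x))) T a with hAop
  have hGb : ∀ p' q' : UT N × Cp, |Ring.inverse Aop (Pi.single q' 1) p'| ≤
      μ₀⁻¹ * Real.exp (-(κ * sdist bsrc btgt n p'.1 q'.1)) * ((n p'.1 : ℝ) * n q'.1) := by
    intro p' q'
    have h := (decay_levelOp S hS hdivS lvl zc hdisj hcover Rm hRm T hT a ha ω hsupp hamax hscale c hc hcoer hκ0 hκ1 hμ p' q').2
    calc |Ring.inverse Aop (Pi.single q' 1) p'|
        ≤ Real.exp (-(κ * sdist bsrc btgt n p'.1 q'.1)) * ((n p'.1 : ℝ) * (n q'.1 : ℝ)) / μ₀ := h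
      _ = μ₀⁻¹ * Real.exp (-(κ * sdist bsrc btgt n p'.1 q'.1)) * ((n p'.1 : ℝ) * n q'.1) := by rw [div_eq_mul_inv]; ring
  exact wrs_le_of_entry_decay_mul (fun x x' => sdist bsrc btgt n x x') (fun x x' => sdist_nonneg bsrc btgt n x x') n
    (Cg := (L : ℝ) ^ A) (c := Real.log L / R) (pow_nonneg (Nat.cast_nonneg _) A)
    (fun x x' => scale_le_scale_mul_exp_add bsrc btgt n hL e hne (A := A) (hadd x x')) hG₀ hΛ hgrowth
    (fun p' q' => Ring.inverse Aop (Pi.single q' 1) p') (B := μ₀⁻¹) (κ := κ) (inv_nonneg.mpr hμ.le) hGb hδ hq p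

/-- **The same for EVERY Dirichlet compression** under the additive grading (constant `min(μ₀,1)⁻¹·L^A`).
[cite: Balaban1988RG2Cluster, (2.16) p.15; Balaban1985BackgroundPropagators, (3.86)-(3.88) pp.408-409] -/
theorem wrs_dirInv_levelOp_le_add (hdisj : ∀ k k' v v', cellPt S hS hdivS lvl zc k v = cellPt S hS hdivS lvl zc k' v' → k = k')
    (hcover : ∀ x : UT N, ∃ k, ∃ v : Box d (S (lvl k)), cellPt S hS hdivS lvl zc k v = x)
    (Rm : UT N × Fin d → Cp → Cp → ℝ) (hRm : ∀ b i j, ∑ k, Rm b k i * Rm b k j = if i = j then (1 : ℝ) else 0)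
    (T : J → UT N → Cp → Cp → ℝ) (hT : ∀ l x i i', ∑ k, T l x k i * T l x k i' = if i = i' then (1 : ℝ) else 0)
    (a : J → ℝ) (ha : ∀ j, 0 ≤ a j) (ω : J → UT N → ℝ)
    (hsupp : ∀ l x, ω l (ctrU N (S l) (tblk (hS l) (hdivS l) x)) ≠ 0 → ∃ k v, lvl k = l ∧ cellPt S hS hdivS lvl zc k v = x)
    {amax : ℝ} (hamax : 0 ≤ amax)
    (hscale : ∀ k, a (lvl k) * ω (lvl k) (ctrU N (S (lvl k)) (zc k)) ^ 2 * (S (lvl k) : ℝ) ^ d ≤ amax / (S (lvl k) : ℝ) ^ 2)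
    (c : UT N × Fin d → ℝ) {cmax : ℝ} (hc : ∀ b, |c b| ≤ cmax) {C : ℝ}
    (hcoer : ∀ f : UT N × Cp → ℝ,
      C * ∑ k, ((S (lvl k) : ℝ) ^ 2)⁻¹ * ∑ v : Box d (S (lvl k)), ∑ i, f (cellPt S hS hdivS lvl zc k v, i) ^ 2 ≤
        ∑ p, f p * levelOp bsrc btgt c Rm (fun l x => ctrU N (S l) (tblk (hS l) (hdivS l) x))
          (fun l x => ω l (ctrU N (S l) (tblk (hS l) (hdivS l) x))) T a f p)
    {κ : ℝ} (hκ0 : 0 ≤ κ) (hκ1 : κ ≤ 1) (hμ : 0 < C - 2 * d * cmax ^ 2 * κ ^ 2 - amax * (Real.exp (2 * d * κ) - 1))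
    (χ : UT N × Cp → ℝ) (hχ : ∀ p, χ p = 0 ∨ χ p = 1)
    {L : ℕ} (hL : 1 ≤ L) (e : UT N → ℕ) (hne : ∀ x, siteScale S hS hdivS lvl zc hcover x = L ^ e x) {R : ℝ} {A : ℕ}
    (hadd : ∀ x y : UT N, |(e x : ℝ) - e y| ≤ A + sdist bsrc btgt (siteScale S hS hdivS lvl zc hcover) x y / R)
    {G₀ Λ : ℝ} (hG₀ : 0 ≤ G₀) (hΛ : 0 ≤ Λ) {d₀ : ℕ}
    (hgrowth : ∀ x (m : ℕ), ((univ.filter fun x' => sdist bsrc btgt (siteScale S hS hdivS lvl zc hcover) x x' < m).card : ℝ) ≤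
      G₀ * (siteScale S hS hdivS lvl zc hcover x : ℝ) ^ d₀ * Λ ^ m)
    {κ' : ℝ} (hδ : 0 ≤ κ - κ' - Real.log L / R) (hq : Λ * Real.exp (-(κ - κ' - Real.log L / R)) < 1) (p : UT N × Cp) :
    ∑ q, |dirInv (levelOp bsrc btgt c Rm (fun l x => ctrU N (S l) (tblk (hS l) (hdivS l) x))
          (fun l x => ω l (ctrU N (S l) (tblk (hS l) (hdivS l) x))) T a) χ (Pi.single q 1) p| *
        Real.exp (κ' * sdist bsrc btgt (siteScale S hS hdivS lvl zc hcover) p.1 q.1) ≤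
      (min (C - 2 * d * cmax ^ 2 * κ ^ 2 - amax * (Real.exp (2 * d * κ) - 1)) 1)⁻¹ * (L : ℝ) ^ A * (Fintype.card Cp) *
        (G₀ * Λ / (1 - Λ * Real.exp (-(κ - κ' - Real.log L / R)))) * (siteScale S hS hdivS lvl zc hcover p.1 : ℝ) ^ (d₀ + 2) := by
  set n := siteScale S hS hdivS lvl zc hcover with hn
  set μ₁ := min (C - 2 * d * cmax ^ 2 * κ ^ 2 - amax * (Real.exp (2 * d * κ) - 1)) 1 with hμ₁
  have hμ₁pos : 0 < μ₁ := lt_min hμ zero_lt_one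
  set Aop := levelOp bsrc btgt c Rm (fun l x => ctrU N (S l) (tblk (hS l) (hdivS l) x))
    (fun l x => ω l (ctrU N (S l) (tblk (hS l) (hdivS l) x))) T a with hAop
  have hGb : ∀ p' q' : UT N × Cp, |dirInv Aop χ (Pi.single q' 1) p'| ≤
      μ₁⁻¹ * Real.exp (-(κ * sdist bsrc btgt n p'.1 q'.1)) * ((n p'.1 : ℝ) * n q'.1) := by
    intro p' q'
    have h := (decay_dirInv_levelOp S hS hdivS lvl zc hdisj hcover Rm hRm T hT a ha ω hsupp hamax hscale c hc hcoer hκ0 hκ1 hμ χ hχ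
      p' q').2
    calc |dirInv Aop χ (Pi.single q' 1) p'|
        ≤ Real.exp (-(κ * sdist bsrc btgt n p'.1 q'.1)) * ((n p'.1 : ℝ) * (n q'.1 : ℝ)) / μ₁ := h
      _ = μ₁⁻¹ * Real.exp (-(κ * sdist bsrc btgt n p'.1 q'.1)) * ((n p'.1 : ℝ) * n q'.1) := by rw [div_eq_mul_inv]; ring
  exact wrs_le_of_entry_decay_mul (fun x x' => sdist bsrc btgt n x x') (fun x x' => sdist_nonneg bsrc btgt n x x') n
    (Cg := (L : ℝ) ^ A) (c := Real.log L / R) (pow_nonneg (Nat.cast_nonneg _) A)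
    (fun x x' => scale_le_scale_mul_exp_add bsrc btgt n hL e hne (A := A) (hadd x x')) hG₀ hΛ hgrowth
    (fun p' q' => dirInv Aop χ (Pi.single q' 1) p') (B := μ₁⁻¹) (κ := κ) (inv_nonneg.mpr hμ₁pos.le) hGb hδ hq p

end Torus

end

end Summit.QuantumFields.BalabanUV.Beta.MultiscaleDecayRowSumsAdd
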